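import Summits.MatrixMultiplication.MatrixMultiplication.Theorems.ObstructionDescentCoordinateDegree

set_option linter.dupNamespace false

/-!
# Obstruction descent, part J — line expansions, killed evaluations and the top coefficient

`route-MatrixMultiplication-ObstructionDescent`, aside `InvariantSaturation` (stmt 32282); decomp-mm lens-3, NODE-g15.
The algebra behind the PAIR LAW H19 (part K, `…ObstructionDescentPairLaw`), on top of parts H (`…SeparateDegree`)
and I (`…CoordinateDegree`).

* **§1 Line expansions.**  For any polynomial `g` on `m×m×m` tensors, any cell `e = (a,b,c)` and any point `y`,
  `u ↦ g(y + u·e_{abc})` is a one-variable polynomial whose coefficients are explicit sums over the monomials of `g`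
  (`line_expansion`); its degree is bounded by the largest exponent of `x_e` in `g` (`lineDegree_of_exponent_le`).
* **§2 Killed evaluations.**  If `f` vanishes at every point whose coordinates outside a set `P` of cells are put
  to zero, every coefficient of `f` at a monomial supported inside `P` vanishes (`coeff_eq_zero_of_evalT_kill`) —
  the formal content of «a DEAD WINDOW kills monomials».
* **§3 The top coefficient.**  For a weight vector `f` of type `Λ` with `Λ₀(a) = Λ₁(b) = Λ₂(c) = k` the
  `u^k`-coefficient of `f(y + u·e_{abc})` is the value at `y` of an explicit homogeneous polynomial `f^{(e)}` of degree
  `d − k` whose monomials are the `x^μ / x_e^k` with `μ_e = k` (`exists_topCoeff`; hand name: `h_k`, the top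
  coefficient of the unit-window calculus H17/H18); `f^{(e)}` is semi-invariant under the stabiliser of `e_{abc}` in
  `GL_m³` (`topCoeff_smul`) and its line degrees transport along that stabiliser from coordinate cells to all triads
  (`lineDegree_topCoeff_triad`, via `exists_det_ne_zero_fix_mulVec`: an invertible matrix fixing `e_o` with a further
  column prescribed up to scale).

[cite: BurgisserIkenmeyer2011, §3.1–3.2 and §6.2] (weight vectors; Strassen's invariant), [cite: LandsbergGCT2017,
§8.3.4] (prolongation: equations of secant varieties from coordinate degrees), [cite: BurgisserIkenmeyer2013,
Prop. 4.2] (evaluation of highest weight vectors at low-rank tensors).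
-/

open scoped BigOperators
open Finset

namespace Summit.MatrixMultiplication.MatrixMultiplication.Theorems.ObstructionCalculus

open Literature.Computability.AlgebraicComplexity (actTensor actTensor_apply actTensor_actTensor actTensor_one
  actTensor_zero actTensor_triad triad triad_apply tensorRank)

variable {m : ℕ}

/-! ### §1 Line expansions -/

section LineExpansion

/-- **Line expansion.**  `u ↦ g(y + u·e_{abc})` is the one-variable polynomial
`Q = Σ_μ g_μ · (X + y_e)^{μ_e} · Π_{p ≠ e} y_p^{μ_p}`; its `u^n`-coefficient is
`Σ_μ g_μ · y_e^{μ_e − n}·C(μ_e, n) · Π_{p ≠ e} y_p^{μ_p}`, and `deg Q ≤ max_μ μ_e`. [bookkeeping] -/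
theorem line_expansion (g : MvPolynomial (Idx m) ℂ) (a b c : Fin m) (y : Tensor ℂ m) :
    ∃ Q : Polynomial ℂ,
      (∀ u : ℂ, evalT (y + u • triad (Pi.single a 1) (Pi.single b 1) (Pi.single c 1)) g = Q.eval u) ∧
      (∀ n : ℕ, Q.coeff n = ∑ μ ∈ g.support, g.coeff μ *
          (y a b c ^ (μ (a, b, c) - n) * ((μ (a, b, c)).choose n : ℂ) *
            ∏ p ∈ μ.support.erase (a, b, c), y p.1 p.2.1 p.2.2 ^ μ p)) ∧
      (∀ δ : ℕ, (∀ μ ∈ g.support, μ (a, b, c) ≤ δ) → Q.natDegree ≤ δ) := by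
  classical
  set e : Idx m := (a, b, c) with he
  set yv : Idx m → ℂ := fun p => y p.1 p.2.1 p.2.2 with hyv
  have hye : yv e = y a b c := by rw [hyv, he]
  set gs : Idx m → Polynomial ℂ := fun p =>
    if p = e then Polynomial.X + Polynomial.C (yv p) else Polynomial.C (yv p) with hgs
  have hgse : gs e = Polynomial.X + Polynomial.C (yv e) := by rw [hgs]; simp
  have hgsne : ∀ p, p ≠ e → gs p = Polynomial.C (yv p) := fun p hp => by rw [hgs]; simp [hp]
  have hterm : ∀ μ : Idx m →₀ ℕ, ∏ p ∈ μ.support, gs p ^ μ p =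
      (Polynomial.X + Polynomial.C (yv e)) ^ μ e * Polynomial.C (∏ p ∈ μ.support.erase e, yv p ^ μ p) := by
    intro μ
    have hrest : ∀ s : Finset (Idx m), e ∉ s →
        ∏ p ∈ s, gs p ^ μ p = Polynomial.C (∏ p ∈ s, yv p ^ μ p) := by
      intro s hs
      rw [map_prod]
      refine Finset.prod_congr rfl fun p hp => ?_
      rw [hgsne p (fun h => hs (h ▸ hp)), map_pow]
    by_cases hmem : e ∈ μ.support
    · rw [← Finset.mul_prod_erase μ.support (fun p => gs p ^ μ p) hmem, hgse,
        hrest _ (Finset.notMem_erase e μ.support)]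
    · rw [Finset.erase_eq_of_notMem hmem, hrest _ hmem, Finsupp.notMem_support_iff.mp hmem, pow_zero, one_mul]
  have hexp : MvPolynomial.aeval gs g = ∑ μ ∈ g.support, Polynomial.C (g.coeff μ) *
      ((Polynomial.X + Polynomial.C (yv e)) ^ μ e * Polynomial.C (∏ p ∈ μ.support.erase e, yv p ^ μ p)) := by
    conv_lhs => rw [g.as_sum]
    rw [map_sum]
    refine Finset.sum_congr rfl fun μ _ => ?_
    rw [MvPolynomial.aeval_monomial, Polynomial.algebraMap_eq, Finsupp.prod, hterm]
  refine ⟨MvPolynomial.aeval gs g, fun u => ?_, fun n => ?_, fun δ hδ => ?_⟩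
  · rw [← Polynomial.coe_aeval_eq_eval, MvPolynomial.comp_aeval_apply, evalT]
    have hfun : (fun p : Idx m => (Polynomial.aeval u) (gs p)) =
        fun p : Idx m => (y + u • triad (Pi.single a (1 : ℂ)) (Pi.single b 1) (Pi.single c 1)) p.1 p.2.1 p.2.2 := by
      funext p
      rw [hgs, he]
      simp only [apply_ite (Polynomial.aeval u), map_add, Polynomial.aeval_C, Algebra.algebraMap_self_apply,
        Polynomial.aeval_X, Pi.add_apply, Pi.smul_apply, smul_eq_mul, triad_single_apply, Prod.mk.eta, hyv]
      split_ifs <;> ring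
    rw [hfun]
  · rw [hexp, Polynomial.finsetSum_coeff]
    refine Finset.sum_congr rfl fun μ _ => ?_
    rw [Polynomial.coeff_C_mul, Polynomial.coeff_mul_C, Polynomial.coeff_X_add_C_pow, hye]
  · rw [hexp]
    refine Polynomial.natDegree_sum_le_of_forall_le _ _ fun μ hμ => ?_
    refine (Polynomial.natDegree_C_mul_le _ _).trans (Polynomial.natDegree_mul_le.trans ?_)
    rw [Polynomial.natDegree_C, add_zero]
    refine Polynomial.natDegree_pow_le.trans ?_
    rw [Polynomial.natDegree_X_add_C, mul_one]
    exact hδ μ hμ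

/-- **Line degree from an exponent bound.**  If `x_e` occurs in `g` only with exponents `≤ δ` then
`u ↦ g(y + u·e)` has degree `≤ δ` at every point `y`. [bookkeeping] -/
theorem lineDegree_of_exponent_le {g : MvPolynomial (Idx m) ℂ} {a b c : Fin m} {δ : ℕ}
    (hδ : ∀ μ ∈ g.support, μ (a, b, c) ≤ δ) (y : Tensor ℂ m) :
    ∃ Q : Polynomial ℂ, Q.natDegree ≤ δ ∧
      ∀ u : ℂ, evalT (y + u • triad (Pi.single a 1) (Pi.single b 1) (Pi.single c 1)) g = Q.eval u := by
  obtain ⟨Q, hQev, -, hQdeg⟩ := line_expansion g a b c y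
  exact ⟨Q, hQdeg δ hδ, hQev⟩

end LineExpansion

/-! ### §2 Killed evaluations -/

section Kill

/-- **Killed evaluations.**  If `f` vanishes at every tensor obtained by putting to zero all coordinates outside a set
`P` of cells, then every coefficient of `f` at a monomial supported inside `P` is zero. [folklore] -/
theorem coeff_eq_zero_of_evalT_kill (f : MvPolynomial (Idx m) ℂ) (P : Fin m → Fin m → Fin m → Prop)
    [∀ x y z, Decidable (P x y z)]
    (hkill : ∀ y : Tensor ℂ m, evalT (fun x y' z => if P x y' z then y x y' z else 0) f = 0)
    {μ : Idx m →₀ ℕ} (hμ : ∀ p ∈ μ.support, P p.1 p.2.1 p.2.2) : f.coeff μ = 0 := by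
  classical
  set S := f.support.filter (fun ν => ∀ p ∈ ν.support, P p.1 p.2.1 p.2.2) with hS
  set fP : MvPolynomial (Idx m) ℂ := ∑ ν ∈ S, MvPolynomial.monomial ν (f.coeff ν) with hfP
  have hev : ∀ x : Idx m → ℂ, MvPolynomial.eval x fP = 0 := by
    intro x
    have h0 := hkill fun a b c => x (a, b, c)
    rw [evalT, MvPolynomial.aeval_eq_eval, MvPolynomial.eval_eq,
      ← Finset.sum_filter_add_sum_filter_not f.support (fun ν => ∀ p ∈ ν.support, P p.1 p.2.1 p.2.2)] at h0
    simp only [Prod.mk.eta] at h0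
    rw [Finset.sum_eq_zero (s := f.support.filter fun ν => ¬∀ p ∈ ν.support, P p.1 p.2.1 p.2.2) ?_,
      add_zero] at h0
    · rw [← h0, hfP, map_sum, hS]
      refine Finset.sum_congr rfl fun ν hν => ?_
      rw [Finset.mem_filter] at hν
      rw [MvPolynomial.eval_monomial, Finsupp.prod]
      congr 1
      refine Finset.prod_congr rfl fun p hp => ?_
      rw [if_pos (hν.2 p hp)]
    · intro ν hν
      rw [Finset.mem_filter] at hν
      obtain ⟨p, hp⟩ := not_forall.mp hν.2
      obtain ⟨hps, hPp⟩ := Classical.not_imp.mp hp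
      rw [Finset.prod_eq_zero hps (by rw [if_neg hPp, zero_pow (Finsupp.mem_support_iff.mp hps)]), mul_zero]
  have hzero : fP = 0 := MvPolynomial.funext fun x => by rw [hev x, map_zero]
  have hc : fP.coeff μ = if μ ∈ S then f.coeff μ else 0 := by
    rw [hfP, MvPolynomial.coeff_sum]
    simp only [MvPolynomial.coeff_monomial]
    rw [Finset.sum_ite_eq']
  rw [hzero, MvPolynomial.coeff_zero] at hc
  by_cases hμS : μ ∈ S
  · rw [if_pos hμS] at hc
    exact hc.symm
  · rw [hS, Finset.mem_filter, not_and] at hμS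
    by_contra hne
    exact hμS (MvPolynomial.mem_support_iff.mpr hne) hμ

end Kill

/-! ### §3 The top coefficient of a weight vector at a saturated cell -/

section TopCoeff

/-- **Top coefficient.**  For a weight vector `f` of type `Λ` and a cell `e = (a,b,c)` carrying the weights
`Λ₀ a = Λ₁ b = Λ₂ c = k`, the `u^k`-coefficient of `f(y + u·e_{abc})` is `f^{(e)}(y)` for the explicit polynomial
`f^{(e)} = Σ_{μ_e = k} f_μ x^{μ − k·e}`, homogeneous of degree `d − k` and free of `x_e`; `deg_u f(y + u e) ≤ k`.
[this node] -/
theorem exists_topCoeff {Λ : Fin 3 → Fin m → ℕ} {d k : ℕ} {f : MvPolynomial (Idx m) ℂ} (hf : f ∈ hwvSpace Λ d)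
    {a b c : Fin m} (ha : Λ 0 a = k) (hb : Λ 1 b = k) (hc : Λ 2 c = k) :
    ∃ g : MvPolynomial (Idx m) ℂ, g.IsHomogeneous (d - k) ∧
      (∀ ν ∈ g.support, ν (a, b, c) = 0 ∧ ∃ μ ∈ f.support, μ (a, b, c) = k ∧ ∀ p, p ≠ (a, b, c) → ν p = μ p) ∧
      ∀ y : Tensor ℂ m, ∃ Q : Polynomial ℂ, Q.natDegree ≤ k ∧ Q.coeff k = evalT y g ∧
        ∀ u : ℂ, evalT (y + u • triad (Pi.single a 1) (Pi.single b 1) (Pi.single c 1)) f = Q.eval u := by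
  classical
  have hEC := fun {μ : Idx m →₀ ℕ} (hμ : μ ∈ f.support) => exponent_at_cell hf ha hb hc hμ
  set e : Idx m := (a, b, c) with he
  set S := f.support.filter (fun μ => μ e = k) with hS
  set g : MvPolynomial (Idx m) ℂ := ∑ μ ∈ S, MvPolynomial.monomial (μ.erase e) (f.coeff μ) with hg
  refine ⟨g, ?_, ?_, fun y => ?_⟩
  · rw [hg]
    refine MvPolynomial.IsHomogeneous.sum _ _ _ fun μ hμ => ?_
    rw [hS, Finset.mem_filter] at hμ
    refine MvPolynomial.isHomogeneous_monomial _ ?_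
    have h1 : d = ∑ i ∈ μ.support, μ i := hf.1.degree_eq_sum_deg_support hμ.1
    have h2 := congrArg Finsupp.degree (Finsupp.single_add_erase e μ)
    rw [map_add, Finsupp.degree_single, hμ.2, Finsupp.degree_apply μ] at h2
    omega
  · intro ν hν
    have hne : g.coeff ν ≠ 0 := MvPolynomial.mem_support_iff.mp hν
    rw [hg, MvPolynomial.coeff_sum] at hne
    simp only [MvPolynomial.coeff_monomial] at hne
    obtain ⟨μ, hμS, hμ⟩ := Finset.exists_ne_zero_of_sum_ne_zero hne
    have hμν : μ.erase e = ν := by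
      by_contra h
      exact hμ (if_neg h)
    rw [hS, Finset.mem_filter] at hμS
    refine ⟨?_, μ, hμS.1, hμS.2, fun p hp => ?_⟩
    · rw [← hμν]
      exact Finsupp.erase_same
    · rw [← hμν]
      exact Finsupp.erase_ne hp
  · obtain ⟨Q, hQev, hQco, hQdeg⟩ := line_expansion f a b c y
    refine ⟨Q, hQdeg k fun μ hμ => (hEC hμ).1, ?_, hQev⟩
    rw [hQco k, hg, evalT, map_sum, hS, Finset.sum_filter]
    refine Finset.sum_congr rfl fun μ hμ => ?_
    by_cases hk : μ e = k
    · rw [if_pos hk, hk, Nat.sub_self, pow_zero, Nat.choose_self, Nat.cast_one, one_mul, one_mul,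
        MvPolynomial.aeval_monomial, Algebra.algebraMap_self_apply, Finsupp.prod, Finsupp.support_erase]
      congr 1
      refine Finset.prod_congr rfl fun p hp => ?_
      rw [Finsupp.erase_ne (Finset.ne_of_mem_erase hp)]
    · rw [if_neg hk, Nat.choose_eq_zero_of_lt (lt_of_le_of_ne (hEC hμ).1 hk), Nat.cast_zero, mul_zero, zero_mul,
        mul_zero]

/-- **Semi-invariance of the top coefficient** under the stabiliser of `e_{abc}`: if `f(h·t) = χ·f(t)` and `h·e = e`
then `f^{(e)}(h·y) = χ·f^{(e)}(y)`. [this node] -/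
theorem topCoeff_smul {f g : MvPolynomial (Idx m) ℂ} {k : ℕ} {E : Tensor ℂ m}
    (htop : ∀ y : Tensor ℂ m, ∃ Q : Polynomial ℂ, Q.natDegree ≤ k ∧ Q.coeff k = evalT y g ∧
      ∀ u : ℂ, evalT (y + u • E) f = Q.eval u)
    {A B C : Matrix (Fin m) (Fin m) ℂ} {χ : ℂ} (hχ : ∀ t : Tensor ℂ m, evalT (actTensor A B C t) f = χ * evalT t f)
    (hE : actTensor A B C E = E) (y : Tensor ℂ m) : evalT (actTensor A B C y) g = χ * evalT y g := by
  obtain ⟨Q₁, -, h₁, h₁'⟩ := htop (actTensor A B C y)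
  obtain ⟨Q₂, -, h₂, h₂'⟩ := htop y
  have hQ : Q₁ = Polynomial.C χ * Q₂ := Polynomial.funext fun u => by
    rw [Polynomial.eval_mul, Polynomial.eval_C, ← h₁' u, ← h₂' u, ← hχ, actTensor_add', actTensor_smul', hE]
  rw [← h₁, ← h₂, hQ, Polynomial.coeff_C_mul]

/-- An invertible matrix FIXING `e_o` and carrying some coordinate vector `e_{a'}` to a prescribed vector up to
scale: `A e_o = e_o`, `σ·A e_{a'} = x`. [folklore] -/
theorem exists_det_ne_zero_fix_mulVec (o : Fin m) (x : Fin m → ℂ) :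
    ∃ (A : Matrix (Fin m) (Fin m) ℂ) (a' : Fin m) (σ : ℂ), A.det ≠ 0 ∧
      A.mulVec (Pi.single o 1) = Pi.single o 1 ∧ σ • A.mulVec (Pi.single a' 1) = x := by
  classical
  by_cases h : ∃ j, j ≠ o ∧ x j ≠ 0
  · obtain ⟨j, hjo, hj⟩ := h
    set M : Matrix (Fin m) (Fin m) ℂ := (1 : Matrix (Fin m) (Fin m) ℂ).updateCol j x with hM
    have hMdet : M.det = x j := by
      have h := Matrix.det_updateCol_sum (1 : Matrix (Fin m) (Fin m) ℂ) j x
      rw [Matrix.det_one, smul_eq_mul, mul_one] at h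
      rw [hM, ← h]
      congr 1
      funext k
      simp [Matrix.one_apply]
    refine ⟨M, j, 1, by rw [hMdet]; exact hj, ?_, ?_⟩
    · rw [Matrix.mulVec_single_one]
      funext i
      simp [hM, Matrix.updateCol_ne hjo.symm, Matrix.one_apply, Pi.single_apply]
    · rw [one_smul, Matrix.mulVec_single_one]
      funext i
      simp [hM, Matrix.updateCol_self]
  · have h' : ∀ j, j ≠ o → x j = 0 := fun j hj => by
      by_contra hne
      exact h ⟨j, hj, hne⟩
    refine ⟨1, o, x o, by simp, by rw [Matrix.one_mulVec], ?_⟩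
    rw [Matrix.one_mulVec]
    funext i
    simp only [Pi.smul_apply, Pi.single_apply, smul_eq_mul]
    by_cases hi : i = o
    · subst hi
      simp
    · rw [if_neg hi, mul_zero, h' i hi]

/-- Scalars pull out of a triad. [bookkeeping] -/
theorem triad_smul_smul_smul (σ₁ σ₂ σ₃ : ℂ) (u v w : Fin m → ℂ) :
    (triad (σ₁ • u) (σ₂ • v) (σ₃ • w) : Tensor ℂ m) = (σ₁ * σ₂ * σ₃) • triad u v w := by
  funext x y z
  simp only [triad_apply, Pi.smul_apply, smul_eq_mul]
  ring

/-- `σ • (u ⊗ v ⊗ w) = (σu) ⊗ v ⊗ w`. [bookkeeping] -/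
theorem smul_triad (σ : ℂ) (u v w : Fin m → ℂ) : σ • (triad u v w : Tensor ℂ m) = triad (σ • u) v w := by
  funext x y z
  simp only [triad_apply, Pi.smul_apply, smul_eq_mul]
  ring

/-- The group action is additive over finite sums. [bookkeeping] -/
theorem actTensor_finset_sum {ι : Type*} (s : Finset ι) (A B C : Matrix (Fin m) (Fin m) ℂ)
    (t : ι → Tensor ℂ m) : actTensor A B C (∑ i ∈ s, t i) = ∑ i ∈ s, actTensor A B C (t i) := by
  classical
  induction s using Finset.induction_on with
  | empty => rw [Finset.sum_empty, Finset.sum_empty, actTensor_zero]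
  | insert i s hi ih => rw [Finset.sum_insert hi, Finset.sum_insert hi, actTensor_add', ih]

/-- **Transport of line degrees of the top coefficient.**  For a full-format level vector `f` with top coefficient
`g = f^{(e)}` at `e = (a,b,c)`: if `v ↦ g(y + v·e')` has degree `≤ δ` for every COORDINATE cell `e'` and every `y`,
then `v ↦ g(w + v·(x ⊗ y ⊗ z))` has degree `≤ δ` for every triad and every `w` (every triad is `σ·h·e'` with
`h ∈ GL_m³` fixing `e_{abc}`, under which `g` is semi-invariant). [this node] -/
theorem lineDegree_topCoeff_triad {k δ : ℕ} {f g : MvPolynomial (Idx m) ℂ}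
    (hf : f ∈ hwvSpace (rectType m m k) (k * m)) {a b c : Fin m}
    (htop : ∀ y : Tensor ℂ m, ∃ Q : Polynomial ℂ, Q.natDegree ≤ k ∧ Q.coeff k = evalT y g ∧
      ∀ u : ℂ, evalT (y + u • triad (Pi.single a 1) (Pi.single b 1) (Pi.single c 1)) f = Q.eval u)
    (hline : ∀ (a' b' c' : Fin m) (y : Tensor ℂ m), ∃ Q : Polynomial ℂ, Q.natDegree ≤ δ ∧
      ∀ v : ℂ, evalT (y + v • triad (Pi.single a' 1) (Pi.single b' 1) (Pi.single c' 1)) g = Q.eval v)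
    (x₁ x₂ x₃ : Fin m → ℂ) (w : Tensor ℂ m) :
    ∃ Q : Polynomial ℂ, Q.natDegree ≤ δ ∧ ∀ v : ℂ, evalT (w + v • triad x₁ x₂ x₃) g = Q.eval v := by
  obtain ⟨A, a', σ₁, hA, hAo, hAx⟩ := exists_det_ne_zero_fix_mulVec a x₁
  obtain ⟨B, b', σ₂, hB, hBo, hBx⟩ := exists_det_ne_zero_fix_mulVec b x₂
  obtain ⟨C, c', σ₃, hC, hCo, hCx⟩ := exists_det_ne_zero_fix_mulVec c x₃
  obtain ⟨χ, -, hχ⟩ := exists_evalT_actTensor_eq_mul hf (fun s i j => rectType_self_const k s i j) hA hB hC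
  have hE : actTensor A B C (triad (Pi.single a (1 : ℂ)) (Pi.single b 1) (Pi.single c 1)) =
      triad (Pi.single a 1) (Pi.single b 1) (Pi.single c 1) := by
    rw [actTensor_triad, hAo, hBo, hCo]
  have hsemi := topCoeff_smul htop hχ hE
  have hdir : (triad x₁ x₂ x₃ : Tensor ℂ m) =
      (σ₁ * σ₂ * σ₃) • actTensor A B C (triad (Pi.single a' 1) (Pi.single b' 1) (Pi.single c' 1)) := by
    rw [actTensor_triad, ← triad_smul_smul_smul, hAx, hBx, hCx]
  have hw : w = actTensor A B C (actTensor A⁻¹ B⁻¹ C⁻¹ w) := by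
    rw [actTensor_actTensor, Matrix.mul_nonsing_inv A (isUnit_iff_ne_zero.mpr hA),
      Matrix.mul_nonsing_inv B (isUnit_iff_ne_zero.mpr hB), Matrix.mul_nonsing_inv C (isUnit_iff_ne_zero.mpr hC),
      actTensor_one]
  obtain ⟨Q, hQδ, hQ⟩ := hline a' b' c' (actTensor A⁻¹ B⁻¹ C⁻¹ w)
  refine ⟨Polynomial.C χ * Q.comp (Polynomial.C (σ₁ * σ₂ * σ₃) * Polynomial.X), ?_, fun v => ?_⟩
  · refine (Polynomial.natDegree_C_mul_le _ _).trans (Polynomial.natDegree_comp_le.trans ?_)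
    calc Q.natDegree * (Polynomial.C (σ₁ * σ₂ * σ₃) * Polynomial.X).natDegree
        ≤ δ * 1 := Nat.mul_le_mul hQδ ((Polynomial.natDegree_C_mul_le _ _).trans Polynomial.natDegree_X_le)
      _ = δ := mul_one δ
  · rw [Polynomial.eval_mul, Polynomial.eval_C, Polynomial.eval_comp, Polynomial.eval_mul, Polynomial.eval_C,
      Polynomial.eval_X, ← hQ, ← hsemi, actTensor_add', actTensor_smul', ← hw, hdir, smul_smul, mul_comm v]

end TopCoeff

end Summit.MatrixMultiplication.MatrixMultiplication.Theorems.ObstructionCalculus
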